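import Summits.SmoothPoincare4.SmoothPoincare4.Theorems.CylinderEntropySliceIsolationReductionCertificates
import Summits.SmoothPoincare4.SmoothPoincare4.Theorems.CylinderEntropySliceIsolationStubCertMidA
import Summits.SmoothPoincare4.SmoothPoincare4.Theorems.CylinderEntropySliceIsolationStubCertMidB
import Summits.SmoothPoincare4.SmoothPoincare4.Theorems.CylinderEntropySliceIsolationStubCertMidC
import HarnessLib

/-!
# `CylinderEntropy.SliceIsolation` from the Chodosh–Mantoulidis–Schulze fact alone (line `conformal-kernel-domination`, chain β)

The crux `Summit.SmoothPoincare4.SmoothPoincare4.Theses.CylinderEntropy.SliceIsolation` (stmt-SmoothPoincare4-7632: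
"a universal `ε > 0`: a homotopy 4-sphere smoothly embedded in `N = S⁴ × ℝ ⊂ ℝ⁶` as an end-separating cross-section
with typed cylinder entropy `< 1 + ε` is diffeomorphic to `S⁴`") now follows from ONE named published fact,
`Literature.Geometry.Riemannian.ChodoshMantoulidisSchulze2025_lowEntropy_sphere_four` (Chodosh–Mantoulidis–Schulze,
Duke 2025, Cor. 1.5 (b), `n = 4`): the mid-scale kernel certificates `10⁻² ≤ T ≤ 10` that the tree's reduction
`sliceIsolation_of_certificates` took as its second hypothesis are PROVED (`stub_certMidA/B/C`: LP certificates
accepted by the kernel-sound computable checker `Cert.checkCover`, evaluated by `native_decide` — so this file is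
COMPUTATIONAL), and all other scales, the measure-theoretic bookkeeping, the conformal embedding and the topological
instances were already in the tree.  The theorem is CONDITIONAL on the CMS fact (the classical debt of the line) and on
nothing else; with `ε = 4/(1.47 e) - 1`.
-/

-- the registered namespace `Summit.SmoothPoincare4.SmoothPoincare4.Theorems…` repeats a component
set_option linter.dupNamespace false

namespace Summit.SmoothPoincare4.SmoothPoincare4.Theorems.CylinderEntropySliceIsolation

open Literature.Geometry.Riemannian.SphericalCylinderEntropy

/-- The mid-scale kernel certificates on `[10⁻², 10]` (the former registered stub `stub_certMid`), from the three
decade stubs. [folklore] -/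
theorem certMid_all :
    ∀ T : ℝ, 1 / 100 ≤ T → T ≤ 10 →
      ∃ (n : ℕ) (σ τ w : Fin n → ℝ) (c : ℝ), (∀ j, 0 < τ j) ∧ (∀ j, 0 ≤ w j) ∧ 0 ≤ c ∧ (∑ j, w j) + c ≤ 147 / 100 ∧
        ∀ u s : ℝ, -1 ≤ s → s ≤ 1 →
          (8 * Real.pi ^ 2 / 3) * ((4 * Real.pi * T) ^ 2)⁻¹ * Real.exp (4 * u) *
              Real.exp (-(Real.exp (2 * u) - 2 * Real.exp u * s + 1) / (4 * T)) ≤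
            (∑ j, w j * (zonal (τ j) s * Real.exp (-(u - σ j) ^ 2 / (4 * τ j)))) + c := by
  intro T h1 h2
  rcases le_or_gt T (1 / 10) with hA | hA
  · exact stub_certMidA T h1 hA
  rcases le_or_gt T 1 with hB | hB
  · exact stub_certMidB T hA.le hB
  · exact stub_certMidC T hB.le h2

/-- **`SliceIsolation` from the CMS fact** (registered helper `helper_sliceIsolationOfCMS` of crux
stmt-SmoothPoincare4-7632; conditional on `ChodoshMantoulidisSchulze2025_lowEntropy_sphere_four` only). [folklore] -/
theorem helper_sliceIsolationOfCMS :
    Literature.Geometry.Riemannian.ChodoshMantoulidisSchulze2025_lowEntropy_sphere_four →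
      Summit.SmoothPoincare4.SmoothPoincare4.Theses.CylinderEntropy.SliceIsolation :=
  fun hCMS => sliceIsolation_of_certificates hCMS certMid_all

end Summit.SmoothPoincare4.SmoothPoincare4.Theorems.CylinderEntropySliceIsolation
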